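import Mathlib.Analysis.MellinTransform
import Mathlib.NumberTheory.LSeries.RiemannZeta
import Mathlib.Analysis.PSeriesComplex
import Literature.NumberTheory.LFunctions.ConnesProlateGuess
import HarnessLib

/-!
# Müntz's formula in the half-plane of absolute convergence, and Connes' summation map `𝓔`

Topic `Literature/NumberTheory/LFunctions` (companion of `RiemannXi.lean` and `ConnesProlateGuess.lean`).
Everything in this file is PROVED; there are no named facts.

* `mellin_tsum_comp_mul_nat` — **Müntz's formula, absolutely convergent case** (Titchmarsh,
  *The Theory of the Riemann Zeta-Function*, §2.11, the first display and the sentence "the process is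
  justifiable if …"): if `F : ℝ → ℂ` has an absolutely convergent Mellin transform at `s` and `Re s > 1`,
  then `x ↦ Σ_{n ≥ 1} F(n x)` has an absolutely convergent Mellin transform at `s` and
  `∫_0^∞ x^{s-1} Σ_{n ≥ 1} F(n x) dx = ζ(s) · ∫_0^∞ y^{s-1} F(y) dy`
  (termwise `∫_0^∞ x^{s-1} F(n x) dx = n^{-s} 𝓜F(s)`, `Σ n^{-s} = ζ(s)`, and `Σ ∫ = ∫ Σ` because
  `Σ_n n^{-σ} ∫ |y^{s-1} F(y)| dy < ∞`).  Titchmarsh's hypothesis "`F` bounded on finite intervals and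
  `O(x^{-α})`, `1 < σ < α`" is one way of guaranteeing the absolute convergence we assume
  (`MellinConvergent F s`); the continuation to `0 < σ < 1` (Müntz's formula proper, (2.11.1)) is not in
  this file.
* `hasSum_mellin_comp_mul_nat` — the same as a `HasSum` over `n`.
* `mellin_connesE` — **Connes' map `𝓔` intertwines the Mellin transform with `ζ(½ + s)`**: with
  `𝓔(f)(u) = u^{1/2} Σ_{n ≥ 1} f(n u)` (`connesE`, Connes 2026 *Letter* §6.1; Connes–Consani–Moscovici 2025,
  (7.2)), `∫_0^∞ 𝓔(f)(u) u^{s-1} du = ζ(½ + s) · ∫_0^∞ f(x) x^{s - 1/2} dx` for `Re s > ½` whenever the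
  right-hand Mellin integral converges absolutely.  This is the computation behind Riemann's / Connes'
  "`Ξ` is the Fourier transform of `k = 𝓔(h)`" (CCM25 (7.1), Lemma 7.1; Letter Fact 6.2): on the critical
  line it is reached from here by Müntz's continuation, using `∫ h = 0`.

## References

* E. C. Titchmarsh, *The Theory of the Riemann Zeta-Function*, 2nd ed. (rev. D. R. Heath-Brown), Oxford 1986,
  §2.11 [Titchmarsh1986].
* A. Connes, *The Riemann Hypothesis: Past, Present and a Letter Through Time*, arXiv:2602.04022 (2026), §6.1
  [Connes2026Letter].
* A. Connes, C. Consani, H. Moscovici, *Zeta Spectral Triples*, arXiv:2511.22755 (2025), §7, (7.1)–(7.2),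
  Lemma 7.1 [ConnesConsaniMoscovici2025].
-/

noncomputable section

open Real Complex MeasureTheory Set Filter

namespace Literature.NumberTheory.LFunctions

/-! ### A summable family of integrable functions sums to an integrable function -/

/-- If `Σ_n ∫ ‖G_n‖ < ∞` for integrable `G_n : α → ℂ`, then `x ↦ Σ_n G_n(x)` is integrable
(monotone convergence for `Σ_n ‖G_n‖` and `‖Σ_n G_n‖ ≤ Σ_n ‖G_n‖`). [folklore] -/
theorem integrable_tsum_of_summable_integral_norm {α : Type*} [MeasurableSpace α] {μ : Measure α}
    {G : ℕ → α → ℂ} (hG : ∀ n, Integrable (G n) μ) (hsum : Summable fun n ↦ ∫ a, ‖G n a‖ ∂μ) :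
    Integrable (fun a ↦ ∑' n, G n a) μ := by
  have hlin : ∀ n, ∫⁻ a, ‖G n a‖ₑ ∂μ = ‖∫ a, ‖G n a‖ ∂μ‖ₑ := by
    intro n
    dsimp [enorm]
    rw [lintegral_coe_eq_integral _ (hG n).norm, ENNReal.coe_nnreal_eq, coe_nnnorm,
      Real.norm_of_nonneg (integral_nonneg (fun a ↦ norm_nonneg (G n a)))]
    simp only [coe_nnnorm]
  have htop : ∑' n, ∫⁻ a, ‖G n a‖ₑ ∂μ ≠ ⊤ := by
    rw [funext hlin]
    exact ENNReal.tsum_coe_ne_top_iff_summable.2 <| NNReal.summable_coe.1 hsum.abs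
  have hS : ∀ᵐ a ∂μ, Summable fun n ↦ ‖G n a‖ := by
    refine summable_norm_of_tsum_eLpNorm_ne_top le_rfl (fun n ↦ (hG n).1) ?_
    simpa only [eLpNorm_one_eq_lintegral_enorm] using htop
  have hmeas : AEStronglyMeasurable (fun a ↦ ∑' n, G n a) μ := by
    refine aestronglyMeasurable_of_tendsto_ae atTop
      (f := fun N a ↦ ∑ n ∈ Finset.range N, G n a) (fun N ↦ ?_) ?_
    · exact Finset.aestronglyMeasurable_fun_sum _ fun n _ ↦ (hG n).1
    · filter_upwards [hS] with a ha using ha.of_norm.hasSum.tendsto_sum_nat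
  have hle : ∫⁻ a, ‖∑' n, G n a‖ₑ ∂μ ≤ ∑' n, ∫⁻ a, ‖G n a‖ₑ ∂μ := by
    calc ∫⁻ a, ‖∑' n, G n a‖ₑ ∂μ ≤ ∫⁻ a, ∑' n, ‖G n a‖ₑ ∂μ :=
          lintegral_mono fun a ↦ enorm_tsum_le_tsum_enorm
      _ = ∑' n, ∫⁻ a, ‖G n a‖ₑ ∂μ := lintegral_tsum fun n ↦ (hG n).1.enorm
  exact ⟨hmeas, lt_of_le_of_lt hle htop.lt_top⟩

/-! ### Müntz's formula for `Re s > 1` -/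

/-- The `L¹` norm of the `n`-th term: for `a > 0`,
`∫_0^∞ ‖x^{s-1} F(a x)‖ dx = a^{-Re s} ∫_0^∞ ‖y^{s-1} F(y)‖ dy` (substitution `y = a x`). [folklore] -/
theorem integral_norm_cpow_smul_comp_mul_left (F : ℝ → ℂ) (s : ℂ) {a : ℝ} (ha : 0 < a) :
    ∫ x : ℝ in Ioi 0, ‖(x : ℂ) ^ (s - 1) • F (a * x)‖ =
      a ^ (-s.re) * ∫ y : ℝ in Ioi 0, ‖(y : ℂ) ^ (s - 1) • F y‖ := by
  set g : ℝ → ℝ := fun y ↦ ‖(y : ℂ) ^ (s - 1) • F y‖ with hg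
  have hpt : EqOn (fun x : ℝ ↦ ‖(x : ℂ) ^ (s - 1) • F (a * x)‖)
      (fun x ↦ a ^ (1 - s.re) * g (a * x)) (Ioi 0) := by
    intro x hx
    have hx' : (0 : ℝ) < x := hx
    simp only [hg, norm_smul, Complex.ofReal_mul]
    rw [Complex.norm_cpow_eq_rpow_re_of_pos hx', Complex.mul_cpow_ofReal_nonneg ha.le hx'.le,
      norm_mul, Complex.norm_cpow_eq_rpow_re_of_pos ha, Complex.norm_cpow_eq_rpow_re_of_pos hx']
    simp only [sub_re, one_re]
    have h1 : a ^ (1 - s.re) * a ^ (s.re - 1) = 1 := by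
      rw [← Real.rpow_add ha]; simp
    calc x ^ (s.re - 1) * ‖F (a * x)‖
        = (a ^ (1 - s.re) * a ^ (s.re - 1)) * (x ^ (s.re - 1) * ‖F (a * x)‖) := by rw [h1, one_mul]
      _ = a ^ (1 - s.re) * (a ^ (s.re - 1) * x ^ (s.re - 1) * ‖F (a * x)‖) := by ring
  rw [setIntegral_congr_fun measurableSet_Ioi hpt, integral_const_mul,
    integral_comp_mul_left_Ioi g 0 ha, mul_zero, smul_eq_mul, ← mul_assoc]
  congr 1
  rw [← Real.rpow_neg_one, ← Real.rpow_add ha]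
  ring_nf

/-- **Müntz's formula in the half-plane of absolute convergence** (Titchmarsh 1986, §2.11): if
`Re s > 1` and `∫_0^∞ |y^{s-1} F(y)| dy < ∞` then `Σ_{n ≥ 1} ∫_0^∞ x^{s-1} F(n x) dx` converges (absolutely)
to `ζ(s) ∫_0^∞ y^{s-1} F(y) dy`, since the `n`-th term is `n^{-s} 𝓜F(s)`. [cite: Titchmarsh1986, §2.11] -/
theorem hasSum_mellin_comp_mul_nat (F : ℝ → ℂ) {s : ℂ} (hs : 1 < s.re) :
    HasSum (fun n : ℕ ↦ mellin (fun x ↦ F (((n + 1 : ℕ) : ℝ) * x)) s) (riemannZeta s * mellin F s) := by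
  have hterm : ∀ n : ℕ, mellin (fun x ↦ F (((n + 1 : ℕ) : ℝ) * x)) s =
      (1 / ((n : ℂ) + 1) ^ s) * mellin F s := by
    intro n
    have hn : (0 : ℝ) < ((n + 1 : ℕ) : ℝ) := Nat.cast_pos.mpr n.succ_pos
    rw [mellin_comp_mul_left F s hn, smul_eq_mul, Complex.cpow_neg, one_div]
    push_cast
    rfl
  simp_rw [hterm]
  refine HasSum.mul_right _ ?_
  rw [zeta_eq_tsum_one_div_nat_add_one_cpow hs]
  refine Summable.hasSum ?_
  have := (Complex.summable_one_div_nat_cpow (p := s)).mpr hs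
  exact (summable_nat_add_iff 1).mpr this |>.congr fun n ↦ by push_cast; rfl

/-- **Müntz's formula, absolutely convergent case** (Titchmarsh 1986, §2.11, first display): for
`F : ℝ → ℂ` with `∫_0^∞ |y^{s-1} F(y)| dy < ∞` and `Re s > 1`, the function `x ↦ Σ_{n ≥ 1} F(n x)` has an
absolutely convergent Mellin transform at `s` and
`∫_0^∞ x^{s-1} (Σ_{n ≥ 1} F(n x)) dx = ζ(s) · ∫_0^∞ y^{s-1} F(y) dy`.
(The interchange `∫ Σ = Σ ∫` is justified by `Σ_n n^{-Re s} ∫_0^∞ |y^{s-1}F(y)| dy < ∞`; at points `x`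
where `Σ_n F(n x)` happens not to converge the `tsum` is `0`, a null set's worth.) [cite: Titchmarsh1986, §2.11] -/
theorem mellin_tsum_comp_mul_nat (F : ℝ → ℂ) {s : ℂ} (hs : 1 < s.re) (hF : MellinConvergent F s) :
    MellinConvergent (fun x ↦ ∑' n : ℕ, F (((n + 1 : ℕ) : ℝ) * x)) s ∧
      mellin (fun x ↦ ∑' n : ℕ, F (((n + 1 : ℕ) : ℝ) * x)) s = riemannZeta s * mellin F s := by
  -- the terms and their integrability
  set G : ℕ → ℝ → ℂ := fun n x ↦ (x : ℂ) ^ (s - 1) • F (((n + 1 : ℕ) : ℝ) * x) with hGdef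
  have hpos : ∀ n : ℕ, (0 : ℝ) < ((n + 1 : ℕ) : ℝ) := fun n ↦ Nat.cast_pos.mpr n.succ_pos
  have hGint : ∀ n, Integrable (G n) (volume.restrict (Ioi 0)) := fun n ↦
    (MellinConvergent.comp_mul_left (f := F) (s := s) (hpos n)).mpr hF
  -- the `L¹` norms are `n^{-σ} · ∫ |y^{s-1} F(y)| dy`, a summable sequence
  have hnorm : ∀ n, ∫ x : ℝ in Ioi 0, ‖G n x‖ =
      ((n + 1 : ℕ) : ℝ) ^ (-s.re) * ∫ y : ℝ in Ioi 0, ‖(y : ℂ) ^ (s - 1) • F y‖ := fun n ↦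
    integral_norm_cpow_smul_comp_mul_left F s (hpos n)
  have hsum : Summable fun n ↦ ∫ x : ℝ in Ioi 0, ‖G n x‖ := by
    simp_rw [hnorm]
    refine Summable.mul_right _ ?_
    have h := Real.summable_nat_rpow.mpr (show -s.re < -1 by linarith)
    exact (summable_nat_add_iff 1).mpr h
  -- pointwise, `x^{s-1} Σ_n F(n x) = Σ_n G_n(x)`
  have hpt : ∀ x : ℝ, (x : ℂ) ^ (s - 1) • (∑' n : ℕ, F (((n + 1 : ℕ) : ℝ) * x)) = ∑' n, G n x := by
    intro x
    simp only [hGdef, smul_eq_mul]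
    exact tsum_mul_left.symm
  refine ⟨?_, ?_⟩
  · -- absolute convergence of the Mellin integral of the sum
    have hI := integrable_tsum_of_summable_integral_norm hGint hsum
    exact hI.congr (Eventually.of_forall fun x ↦ (hpt x).symm)
  · calc mellin (fun x ↦ ∑' n : ℕ, F (((n + 1 : ℕ) : ℝ) * x)) s
        = ∫ x : ℝ in Ioi 0, ∑' n, G n x := by
          simp only [mellin, hpt]
      _ = ∑' n, ∫ x : ℝ in Ioi 0, G n x := (integral_tsum_of_summable_integral_norm hGint hsum).symm
      _ = ∑' n : ℕ, mellin (fun x ↦ F (((n + 1 : ℕ) : ℝ) * x)) s := rfl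
      _ = riemannZeta s * mellin F s := (hasSum_mellin_comp_mul_nat F hs).tsum_eq

/-! ### Connes' summation map `𝓔` -/

/-- On `u > 0`, Connes' `𝓔(f)(u) = u^{1/2} Σ_{n ≥ 1} f(n u)` (Connes 2026, Letter §6.1; CCM25 (7.2)) is
`u^{1/2} · Σ_{n ≥ 1} f(n u)` with the complex power `u^{1/2}`. [cite: Connes2026Letter, §6.1] -/
theorem connesE_ofReal_eq {f : ℝ → ℝ} {u : ℝ} (hu : 0 < u) :
    (connesE f u : ℂ) = (u : ℂ) ^ ((1 / 2 : ℂ)) • ∑' n : ℕ, ((f (((n + 1 : ℕ) : ℝ) * u) : ℝ) : ℂ) := by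
  rw [connesE, Complex.ofReal_mul, Complex.ofReal_tsum, smul_eq_mul, Real.sqrt_eq_rpow,
    Complex.ofReal_cpow hu.le]
  push_cast
  rfl

/-- **`𝓔` intertwines the Mellin transform with multiplication by `ζ(½ + s)`** (the computation behind
Connes 2026, Letter §6.1–6.2 / Fact 6.2, and Connes–Consani–Moscovici 2025, (7.1)–(7.2), Lemma 7.1; it is
Müntz's formula, Titchmarsh §2.11, for `F = f` at `½ + s`): if `Re s > ½` and
`∫_0^∞ |f(x)| x^{Re s - 1/2} dx < ∞`, then the Mellin transform of `𝓔(f)` converges absolutely at `s` and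
`∫_0^∞ 𝓔(f)(u) u^{s-1} du = ζ(½ + s) · ∫_0^∞ f(x) x^{s - 1/2} dx`.
For Connes' `h` (and `h_λ`), which have `∫ h = 0`, the identity persists on `|Re s| < ½` by analytic
continuation (Müntz (2.11.1)); that continuation is not proved here. [cite: Connes2026Letter, §6.1] -/
theorem mellin_connesE (f : ℝ → ℝ) {s : ℂ} (hs : 1 / 2 < s.re)
    (hf : MellinConvergent (fun x ↦ (f x : ℂ)) (s + 1 / 2)) :
    MellinConvergent (fun u ↦ (connesE f u : ℂ)) s ∧
      mellin (fun u ↦ (connesE f u : ℂ)) s =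
        riemannZeta (s + 1 / 2) * mellin (fun x ↦ (f x : ℂ)) (s + 1 / 2) := by
  have hs' : 1 < (s + 1 / 2).re := by
    simp only [add_re, one_div]
    norm_num
    linarith
  obtain ⟨hconv, heq⟩ := mellin_tsum_comp_mul_nat (fun x ↦ (f x : ℂ)) hs' hf
  have hEq : EqOn (fun u : ℝ ↦ (connesE f u : ℂ))
      (fun u ↦ (u : ℂ) ^ ((1 / 2 : ℂ)) • ∑' n : ℕ, ((f (((n + 1 : ℕ) : ℝ) * u) : ℝ) : ℂ)) (Ioi 0) :=
    fun u hu ↦ connesE_ofReal_eq hu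
  refine ⟨?_, ?_⟩
  · have h1 : MellinConvergent
        (fun u : ℝ ↦ (u : ℂ) ^ ((1 / 2 : ℂ)) • ∑' n : ℕ, ((f (((n + 1 : ℕ) : ℝ) * u) : ℝ) : ℂ)) s :=
      MellinConvergent.cpow_smul.mpr hconv
    rw [MellinConvergent] at h1 ⊢
    refine (integrableOn_congr_fun ?_ measurableSet_Ioi).mpr h1
    intro u hu
    simp only [hEq hu]
  · rw [← heq, ← mellin_cpow_smul]
    exact setIntegral_congr_fun measurableSet_Ioi fun u hu ↦ by simp only [hEq hu]

end Literature.NumberTheory.LFunctions
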